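import Literature.MathematicalPhysics.KineticTheory.LangevinChainTheorem51
import HarnessLib

/-!
# `HiddenChargeMazur.StaticKubo`, line `birth`, stub `stub_highEnergyDecayRate` — auxiliary lemmas

Helper file (`--supports stmt-AtomisticToContinuum-13510`, crux decl `HiddenChargeMazur.StaticKubo`,
skeleton `Cruxes/StaticKubo/Lines/birth.lean`, rev 4, registered auxiliary stub
`stub_highEnergyDecayRate_bookkeeping` for the stub `stub_highEnergyDecayRate`).

The stub `stub_highEnergyDecayRate` is Cuneo–Eckmann–Hairer–Rey-Bellet 2018, Theorem 5.1 for the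
pinned anharmonic chain WITH A RATE: `E_x e^{θH(X_{t*})} ≤ C exp(θH(x) − cH(x)^{3/4})` above an
energy threshold. Its proof re-runs the in-tree grid decomposition of
`pinnedChain_lintegral_exp_hamiltonian_small` (`LangevinChainTheorem51.lean`) with a sub-Gaussian
tail for the running supremum of the Brownian pair in place of the `O(h²)` Doob tail. This file
supplies the pieces of that proof which do not need the event bookkeeping:

* `highEnergyDecayRate_grid` — the deterministic time grid `J = ⌊t* a/Λ₀⌋`, `τ = t*/J`,
  `Λ₀/a ≤ τ ≤ 2Λ₀/a`, `Jτ = t*`;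
* `highEnergyDecayRate_noiseCell_le` — the law of a shifted bad noise cell under the sub-Gaussian
  tail hypothesis: `P(θ_s ω ∉ goodPaths (m₁a) τ) ≤ max(C,0) e^{-(c m₁²/(2Λ₀)) a³}` for `τ ≤ 2Λ₀/a`;
* `highEnergyDecayRate_restart_le` — the low-energy restart bound (CEHR (5.15)):
  `E[e^{θH(z_{t*})}; H(z_s) < c] ≤ e^{θγ(T_L+T_R)t*} e^{θc}` (simple Markov property + (3.4));
* `highEnergyDecayRate_mul_exp_le`, `highEnergyDecayRate_sqrt_sqrt_pow_three` — elementary;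
* `stub_highEnergyDecayRate_bookkeeping` — the final real-number bookkeeping: the three terms of
  the decomposition sum to `≤ C exp(θE − c a³)` (`E = a⁴`) for `a` large.

References: N. Cuneo, J.-P. Eckmann, M. Hairer, L. Rey-Bellet, EJP 23 (2018) no. 55, Thm 5.1,
eqs. (5.14)–(5.16); folklore.
-/

noncomputable section

open MeasureTheory ProbabilityTheory Filter Topology Set Metric Finset
open scoped NNReal ENNReal
open Literature.MathematicalPhysics.KineticTheory.HeatConduction Literature.MathematicalPhysics.KineticTheory
open Literature.Probability.Process OscillatorChain

namespace Summit.AtomisticToContinuum.FouriersLaw.Cruxes.StaticKubo.Birth.Stubs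

/-! ### The deterministic grid -/

/-- **The time grid** (CEHR (5.5) on a deterministic grid): for `a ≥ 2Λ₀/t*` there are `J ≥ 1`
cells of length `τ = t*/J` with `Λ₀/a ≤ τ ≤ 2Λ₀/a`, `Jτ = t*` and `J ≤ t* a/Λ₀` (`J = ⌊t* a/Λ₀⌋`).
[folklore] -/
theorem highEnergyDecayRate_grid {Λ₀ tstar a : ℝ} (hΛ₀ : 0 < Λ₀) (hts : 0 < tstar) (ha0 : 0 < a)
    (hΛa : 2 * Λ₀ / tstar ≤ a) :
    ∃ (J : ℕ) (τ : ℝ), 0 < τ ∧ (1 : ℝ) ≤ J ∧ (J : ℝ) * τ = tstar ∧ Λ₀ / a ≤ τ ∧ τ ≤ 2 * Λ₀ / a ∧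
      (J : ℝ) ≤ tstar / Λ₀ * a := by
  set r : ℝ := tstar * a / Λ₀ with hr
  have hr2 : 2 ≤ r := by
    rw [hr, le_div_iff₀ hΛ₀]
    have := (div_le_iff₀ hts).1 hΛa
    nlinarith only [this, hts.le]
  set J : ℕ := ⌊r⌋₊ with hJ
  have hJle : (J : ℝ) ≤ r := Nat.floor_le (by linarith only [hr2])
  have hJlt : r < J + 1 := Nat.lt_floor_add_one r
  have hJ1 : (1 : ℝ) ≤ J := by
    have : (1 : ℝ) < J := by linarith only [hr2, hJlt]
    exact this.le
  have hJpos : (0 : ℝ) < J := by linarith only [hJ1]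
  refine ⟨J, tstar / J, div_pos hts hJpos, hJ1, ?_, ?_, ?_, ?_⟩
  · field_simp
  · rw [div_le_div_iff₀ ha0 hJpos]
    have : (J : ℝ) * Λ₀ ≤ tstar * a := by
      have := hJle
      rw [hr, le_div_iff₀ hΛ₀] at this
      linarith only [this]
    linarith only [this]
  · rw [div_le_div_iff₀ hJpos ha0]
    have : tstar * a ≤ 2 * Λ₀ * J := by
      have h2J : r ≤ 2 * J := by linarith only [hJlt, hJ1]
      rw [hr, div_le_iff₀ hΛ₀] at h2J
      linarith only [h2J]
    linarith only [this]
  · rw [div_mul_eq_mul_div]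
    exact hJle

/-! ### The noise cells under the sub-Gaussian running-sup tail -/

/-- **The bad noise cells are sub-exponentially rare in `a³`**: if the running supremum of the
Brownian pair has the sub-Gaussian tail `P((goodEvent a h)ᶜ) ≤ C e^{-c a²/h}` (`c ≥ 0`), then for a cell of
length `τ ≤ 2Λ₀/a` and the noise threshold `m₁ a`, the shifted bad event has probability
`≤ max(C,0) e^{-(c m₁²/(2Λ₀)) a³}` (law of the shifted pair = law of the pair,
`measure_pairShift_not_mem_goodPaths`; `(m₁a)²/τ ≥ m₁² a³/(2Λ₀)`). [folklore] -/
theorem highEnergyDecayRate_noiseCell_le {Cg cg : ℝ}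
    (hTail : ∀ (a : ℝ) (h : ℝ≥0), 0 < a → 0 < (h : ℝ) →
      wienerPair (goodEvent a h)ᶜ ≤ ENNReal.ofReal (Cg * Real.exp (-(cg * a ^ 2 / h))))
    (hcg : 0 ≤ cg) {Λ₀ m₁ a τ : ℝ} (hΛ₀ : 0 < Λ₀) (hm₁ : 0 < m₁) (ha : 0 < a) (hτ0 : 0 < τ)
    (hτ2 : τ ≤ 2 * Λ₀ / a) (s : ℝ≥0) :
    wienerPair {ω | pairShift s ω ∉ goodPaths (m₁ * a) τ.toNNReal} ≤
      ENNReal.ofReal (max Cg 0 * Real.exp (-(cg * m₁ ^ 2 / (2 * Λ₀) * a ^ 3))) := by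
  rw [measure_pairShift_not_mem_goodPaths]
  have hτ' : ((τ.toNNReal : ℝ≥0) : ℝ) = τ := Real.coe_toNNReal τ hτ0.le
  refine (hTail (m₁ * a) τ.toNNReal (by positivity) (by rw [hτ']; exact hτ0)).trans
    (ENNReal.ofReal_le_ofReal ?_)
  rw [hτ']
  have hexp : Real.exp (-(cg * (m₁ * a) ^ 2 / τ)) ≤ Real.exp (-(cg * m₁ ^ 2 / (2 * Λ₀) * a ^ 3)) := by
    refine Real.exp_le_exp.2 (neg_le_neg ?_)
    have ha' := ha.ne'
    have hΛ₀' := hΛ₀.ne'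
    have h1 : cg * m₁ ^ 2 / (2 * Λ₀) * a ^ 3 = cg * (m₁ * a) ^ 2 / (2 * Λ₀ / a) := by
      field_simp
    rw [h1]
    exact div_le_div_of_nonneg_left (by positivity) hτ0 hτ2
  calc Cg * Real.exp (-(cg * (m₁ * a) ^ 2 / τ)) ≤ max Cg 0 * Real.exp (-(cg * (m₁ * a) ^ 2 / τ)) :=
        mul_le_mul_of_nonneg_right (le_max_left _ _) (Real.exp_pos _).le
    _ ≤ _ := mul_le_mul_of_nonneg_left hexp (le_max_right _ _)

/-! ### The low-energy restart bound -/

section Restart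

variable {ω₂ lam β γ : ℝ} (hω : 0 < ω₂) (hl : 0 ≤ lam) (hβ : 0 ≤ β) (hγ : 0 ≤ γ) {N : ℕ} (hN : 0 < N)
  {T_L T_R : ℝ} (hTL : 0 < T_L) (hTR : 0 < T_R) {θ : ℝ} (hθ : 0 < θ) (hθ' : θ < 1 / max T_L T_R)
include hω hl hβ hγ hN hTL hTR hθ hθ'

-- the flow is a limit of Picard iterations: never let the unifier unfold it (heartbeats)
attribute [local irreducible] OscillatorChain.chainFlow

/-- **Low energy at a grid time** (CEHR (5.15), the event `A₂`): for `0 ≤ s ≤ t*` and a level `c`,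
`E[e^{θH(z_{t*})}; H(z_s) < c] ≤ e^{θγ(T_L+T_R)t*} e^{θc}` — restart at time `s` (simple Markov
property, `pinnedChain_lintegral_indicator_exp_hamiltonian_restart_le`) and bound `e^{θH(z_s)} ≤ e^{θc}`
on the event. [cite: CuneoEckmannHairerReyBellet2018, Thm 5.1 (proof, eq. (5.15))] -/
theorem highEnergyDecayRate_restart_le {tstar s : ℝ} (hs0 : 0 ≤ s) (hs : s ≤ tstar)
    (x : PhaseSpace N) (c : ℝ) :
    ∫⁻ ω, {ω | (pinnedChain ω₂ lam β γ).hamiltonian N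
        ((pinnedChain ω₂ lam β γ).solMap N T_L T_R s x (pairPath ω)) < c}.indicator
        (fun ω => ENNReal.ofReal (Real.exp (θ * (pinnedChain ω₂ lam β γ).hamiltonian N
          ((pinnedChain ω₂ lam β γ).solMap N T_L T_R tstar x (pairPath ω))))) ω ∂wienerPair ≤
      ENNReal.ofReal (Real.exp (θ * γ * (T_L + T_R) * tstar) * Real.exp (θ * c)) := by
  set P := pinnedChain ω₂ lam β γ with hP
  set H := P.hamiltonian N with hH
  have hHm : Measurable H := (pinnedChain_continuous_hamiltonian ω₂ lam β γ N).measurable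
  set B : Set (PhaseSpace N) := {y | H y < c} with hB
  have hBm : MeasurableSet B := measurableSet_lt hHm measurable_const
  set F : WienerPair → ℝ≥0∞ := fun ω =>
    ENNReal.ofReal (Real.exp (θ * H (P.solMap N T_L T_R tstar x (pairPath ω)))) with hF
  set D : Set WienerPair := {ω | H (P.solMap N T_L T_R s x (pairPath ω)) < c} with hD
  have hind : ∀ ω, D.indicator F ω = B.indicator 1 (P.solMap N T_L T_R s x (pairPath ω)) * F ω :=
    fun ω => by
    by_cases hω : ω ∈ D
    · have : P.solMap N T_L T_R s x (pairPath ω) ∈ B := hω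
      rw [Set.indicator_of_mem hω, Set.indicator_of_mem this, Pi.one_apply, one_mul]
    · have : P.solMap N T_L T_R s x (pairPath ω) ∉ B := hω
      rw [Set.indicator_of_notMem hω, Set.indicator_of_notMem this, zero_mul]
  show ∫⁻ ω, D.indicator F ω ∂wienerPair ≤ _
  simp_rw [hind]
  have hu : 0 ≤ tstar - s := by linarith only [hs]
  have hsj : ((s.toNNReal : ℝ≥0) : ℝ) = s := Real.coe_toNNReal _ hs0
  have hR := pinnedChain_lintegral_indicator_exp_hamiltonian_restart_le hω hl hβ hγ hN hTL hTR hθ hθ'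
    s.toNNReal hu x hBm
  rw [hsj, show s + (tstar - s) = tstar by ring] at hR
  refine hR.trans ?_
  have hpt : ∀ ω, B.indicator 1 (P.solMap N T_L T_R s x (pairPath ω)) *
      ENNReal.ofReal (Real.exp (θ * P.hamiltonian N (P.solMap N T_L T_R s x (pairPath ω)))) ≤
      ENNReal.ofReal (Real.exp (θ * c)) := by
    intro ω
    by_cases hω : P.solMap N T_L T_R s x (pairPath ω) ∈ B
    · rw [Set.indicator_of_mem hω, Pi.one_apply, one_mul]
      refine ENNReal.ofReal_le_ofReal (Real.exp_le_exp.2 ?_)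
      have : H (P.solMap N T_L T_R s x (pairPath ω)) < c := hω
      nlinarith only [this, hθ]
    · rw [Set.indicator_of_notMem hω, zero_mul]; exact bot_le
  calc ENNReal.ofReal (Real.exp (θ * γ * (T_L + T_R) * (tstar - s))) *
        ∫⁻ ω, B.indicator 1 (P.solMap N T_L T_R s x (pairPath ω)) *
          ENNReal.ofReal (Real.exp (θ * P.hamiltonian N (P.solMap N T_L T_R s x (pairPath ω)))) ∂wienerPair
      ≤ ENNReal.ofReal (Real.exp (θ * γ * (T_L + T_R) * tstar)) *
          ∫⁻ _ω, ENNReal.ofReal (Real.exp (θ * c)) ∂wienerPair := by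
        refine mul_le_mul' (ENNReal.ofReal_le_ofReal (Real.exp_le_exp.2 ?_)) (lintegral_mono hpt)
        have hC0 : 0 ≤ θ * γ * (T_L + T_R) := by positivity
        exact mul_le_mul_of_nonneg_left (by linarith only [hs0]) hC0
    _ = _ := by
        rw [lintegral_const, measure_univ, mul_one, ← ENNReal.ofReal_mul (Real.exp_pos _).le]

end Restart

/-! ### Elementary real bookkeeping -/

/-- `a e^{-k a³} ≤ e^{-(k/2) a³}` once `a ≥ 1` and `a ≥ 2/k` (`k > 0`): indeed
`a ≤ (k/2)a³ ≤ e^{(k/2)a³}`. [folklore] -/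
theorem highEnergyDecayRate_mul_exp_le {k a : ℝ} (hk : 0 < k) (ha1 : 1 ≤ a) (hak : 2 / k ≤ a) :
    a * Real.exp (-(k * a ^ 3)) ≤ Real.exp (-(k / 2 * a ^ 3)) := by
  have hka : 2 ≤ a * k := (div_le_iff₀ hk).1 hak
  have h1 : a ≤ k / 2 * a ^ 3 := by
    have ha0 : 0 ≤ a := by linarith only [ha1]
    have h2 : 1 ≤ a * k / 2 * a := by nlinarith only [hka, ha1]
    have h3 : k / 2 * a ^ 3 = (a * k / 2 * a) * a := by ring
    rw [h3]
    nlinarith only [h2, ha0]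
  have h2 : a ≤ Real.exp (k / 2 * a ^ 3) :=
    h1.trans ((le_add_of_nonneg_right zero_le_one).trans (Real.add_one_le_exp _))
  have h3 : Real.exp (-(k * a ^ 3)) = Real.exp (-(k / 2 * a ^ 3)) * Real.exp (-(k / 2 * a ^ 3)) := by
    rw [← Real.exp_add]
    congr 1
    ring
  have h4 : a * Real.exp (-(k / 2 * a ^ 3)) ≤ 1 := by
    rw [Real.exp_neg, ← div_eq_mul_inv, div_le_one (Real.exp_pos _)]
    exact h2
  rw [h3, ← mul_assoc]
  calc a * Real.exp (-(k / 2 * a ^ 3)) * Real.exp (-(k / 2 * a ^ 3))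
      ≤ 1 * Real.exp (-(k / 2 * a ^ 3)) := mul_le_mul_of_nonneg_right h4 (Real.exp_pos _).le
    _ = _ := one_mul _

/-- `(√√E)³ = E^{3/4}` for `E ≥ 0`. [folklore] -/
theorem highEnergyDecayRate_sqrt_sqrt_pow_three {E : ℝ} (hE : 0 ≤ E) :
    Real.sqrt (Real.sqrt E) ^ 3 = E ^ (3 / 4 : ℝ) := by
  rw [Real.sqrt_eq_rpow, Real.sqrt_eq_rpow, ← Real.rpow_mul hE, ← Real.rpow_natCast,
    ← Real.rpow_mul hE]
  norm_num

/-- **The bookkeeping of CEHR Theorem 5.1 with a rate** (registered auxiliary stub for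
`stub_highEnergyDecayRate`). With `E = a⁴`, `K₀ = e^{K}` (`K = θγ(T_L+T_R)t*`), `J ≤ b a` grid cells,
the three terms of the grid decomposition — large dissipation `e^{-κ g_t E} e^{θE + K}`, low grid
energy `(J+1) K₀ e^{θE/2}`, and the Hölder term `K₀ e^{θE} (P(bad))^{r}` with
`P(bad) ≤ (J+1) e^{-3θE/2} K₀ e^{θE} + J · C_g e^{-c' a³}` — sum to at most `C exp(θE − c a³)` for
`a ≥ A`, with `c = r · min(κ g_t, θ/2, c')/2 > 0`. Elementary: `a⁴ ≥ a³` for `a ≥ 1`,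
`a e^{-k a³} ≤ e^{-(k/2)a³}` for `a ≥ 2/k`, `(M e^{-y})^r = M^r e^{-r y}`. [folklore] -/
theorem stub_highEnergyDecayRate_bookkeeping : ∀ (θ κ K gt b Cg c' r : ℝ), 0 < θ → 0 < κ → 0 < gt → 0 ≤ b → 0 ≤ Cg → 0 < c' → 0 < r → r ≤ 1 → ∃ c C A : ℝ, 0 < c ∧ 1 ≤ A ∧ ∀ (a E : ℝ) (J : ℕ), A ≤ a → a ^ 4 = E → (J : ℝ) ≤ b * a → Real.exp (-(κ * (gt * E))) * Real.exp (θ * E + K) + ((J : ℝ) + 1) * (Real.exp K * Real.exp (θ * (E / 2))) + Real.exp K * Real.exp (θ * E) * (((J : ℝ) + 1) * (Real.exp (-(θ * (3 * E / 2))) * (Real.exp K * Real.exp (θ * E))) + (J : ℝ) * (Cg * Real.exp (-(c' * a ^ 3)))) ^ r ≤ C * Real.exp (θ * E - c * a ^ 3) := by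
  intro θ κ K gt b Cg c' r hθ hκ hgt hb hCg hc' hr hr1
  set K₀ : ℝ := Real.exp K with hK₀
  have hK₀0 : 0 < K₀ := Real.exp_pos _
  -- the common rate `k` and the constant `M`
  set k : ℝ := min (min (κ * gt) (θ / 2)) c' with hk
  have hk0 : 0 < k := lt_min (lt_min (mul_pos hκ hgt) (half_pos hθ)) hc'
  have hk1 : k ≤ κ * gt := (min_le_left _ _).trans (min_le_left _ _)
  have hk2 : k ≤ θ / 2 := (min_le_left _ _).trans (min_le_right _ _)
  have hk3 : k ≤ c' := min_le_right _ _
  set M : ℝ := (b + 1) * K₀ + b * Cg with hM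
  have hM0 : 0 ≤ M := by positivity
  refine ⟨k * r / 2, K₀ * (2 + b + M ^ r), max 1 (2 / k), by positivity, le_max_left _ _, ?_⟩
  intro a E J ha ha4 hJ
  subst ha4
  have ha1 : 1 ≤ a := (le_max_left _ _).trans ha
  have hak : 2 / k ≤ a := (le_max_right _ _).trans ha
  have ha0 : 0 < a := by linarith only [ha1]
  have h34 : a ^ 3 ≤ a ^ 4 := pow_le_pow_right₀ ha1 (by norm_num)
  have hdec := highEnergyDecayRate_mul_exp_le hk0 ha1 hak
  -- comparison of the exponential factors with `e^{-k a³}`, `e^{-(k/2) a³}`, `e^{-(kr/2) a³}`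
  have he1 : Real.exp (-(κ * (gt * a ^ 4))) ≤ Real.exp (-(k * a ^ 3)) := by
    refine Real.exp_le_exp.2 (neg_le_neg ?_)
    calc k * a ^ 3 ≤ (κ * gt) * a ^ 4 := mul_le_mul hk1 h34 (by positivity) (by positivity)
      _ = κ * (gt * a ^ 4) := by ring
  have he2 : Real.exp (-(θ / 2 * a ^ 4)) ≤ Real.exp (-(k * a ^ 3)) :=
    Real.exp_le_exp.2 (neg_le_neg (mul_le_mul hk2 h34 (by positivity) (by positivity)))
  have he3 : Real.exp (-(c' * a ^ 3)) ≤ Real.exp (-(k * a ^ 3)) :=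
    Real.exp_le_exp.2 (neg_le_neg (mul_le_mul_of_nonneg_right hk3 (by positivity)))
  have ha3 : 0 < a ^ 3 := by positivity
  have he4 : Real.exp (-(k * a ^ 3)) ≤ Real.exp (-(k / 2 * a ^ 3)) :=
    Real.exp_le_exp.2 (neg_le_neg (by nlinarith only [hk0, ha3]))
  have hkr : k * r / 2 ≤ k / 2 := by nlinarith only [hk0, hr1]
  have he5 : Real.exp (-(k / 2 * a ^ 3)) ≤ Real.exp (-(k * r / 2 * a ^ 3)) :=
    Real.exp_le_exp.2 (neg_le_neg (mul_le_mul_of_nonneg_right hkr ha3.le))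
  -- factor out `e^{θ a⁴}`
  have hx1 : Real.exp (-(κ * (gt * a ^ 4))) * Real.exp (θ * a ^ 4 + K) =
      Real.exp (θ * a ^ 4) * (K₀ * Real.exp (-(κ * (gt * a ^ 4)))) := by
    rw [Real.exp_add]; ring
  have hx2 : K₀ * Real.exp (θ * (a ^ 4 / 2)) = Real.exp (θ * a ^ 4) * (K₀ * Real.exp (-(θ / 2 * a ^ 4))) := by
    have : θ * (a ^ 4 / 2) = θ * a ^ 4 + -(θ / 2 * a ^ 4) := by ring
    rw [this, Real.exp_add]; ring
  have hu1 : Real.exp (-(θ * (3 * a ^ 4 / 2))) * (K₀ * Real.exp (θ * a ^ 4)) =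
      K₀ * Real.exp (-(θ / 2 * a ^ 4)) := by
    have : -(θ / 2 * a ^ 4) = -(θ * (3 * a ^ 4 / 2)) + θ * a ^ 4 := by ring
    rw [this, Real.exp_add]; ring
  rw [hx1, hx2, hu1, show θ * a ^ 4 - k * r / 2 * a ^ 3 = θ * a ^ 4 + -(k * r / 2 * a ^ 3) by ring,
    Real.exp_add]
  set D : ℝ := Real.exp (-(k * r / 2 * a ^ 3)) with hD
  set Y : ℝ := ((J : ℝ) + 1) * (K₀ * Real.exp (-(θ / 2 * a ^ 4))) + (J : ℝ) * (Cg * Real.exp (-(c' * a ^ 3)))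
    with hY
  have hJ1 : (J : ℝ) + 1 ≤ (b + 1) * a := by nlinarith only [hJ, ha1, hb]
  -- (T1) large dissipation
  have hT1 : K₀ * Real.exp (-(κ * (gt * a ^ 4))) ≤ K₀ * D :=
    mul_le_mul_of_nonneg_left (he1.trans (he4.trans he5)) hK₀0.le
  -- (T2) low grid energy
  have hT2 : ((J : ℝ) + 1) * (K₀ * Real.exp (-(θ / 2 * a ^ 4))) ≤ (b + 1) * K₀ * D := by
    calc ((J : ℝ) + 1) * (K₀ * Real.exp (-(θ / 2 * a ^ 4)))
        ≤ ((b + 1) * a) * (K₀ * Real.exp (-(k * a ^ 3))) :=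
          mul_le_mul hJ1 (mul_le_mul_of_nonneg_left he2 hK₀0.le) (by positivity) (by positivity)
      _ = (b + 1) * K₀ * (a * Real.exp (-(k * a ^ 3))) := by ring
      _ ≤ (b + 1) * K₀ * Real.exp (-(k / 2 * a ^ 3)) := mul_le_mul_of_nonneg_left hdec (by positivity)
      _ ≤ (b + 1) * K₀ * D := mul_le_mul_of_nonneg_left he5 (by positivity)
  -- (T3) the bad events
  have hYle : Y ≤ M * Real.exp (-(k / 2 * a ^ 3)) := by
    calc Y ≤ ((b + 1) * a) * (K₀ * Real.exp (-(k * a ^ 3))) + (b * a) * (Cg * Real.exp (-(k * a ^ 3))) :=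
          add_le_add (mul_le_mul hJ1 (mul_le_mul_of_nonneg_left he2 hK₀0.le) (by positivity) (by positivity))
            (mul_le_mul hJ (mul_le_mul_of_nonneg_left he3 hCg) (by positivity) (by positivity))
      _ = M * (a * Real.exp (-(k * a ^ 3))) := by rw [hM]; ring
      _ ≤ M * Real.exp (-(k / 2 * a ^ 3)) := mul_le_mul_of_nonneg_left hdec hM0
  have hY0 : 0 ≤ Y := by positivity
  have hYr : Y ^ r ≤ M ^ r * D := by
    calc Y ^ r ≤ (M * Real.exp (-(k / 2 * a ^ 3))) ^ r := Real.rpow_le_rpow hY0 hYle hr.le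
      _ = M ^ r * Real.exp (-(k / 2 * a ^ 3)) ^ r := Real.mul_rpow hM0 (Real.exp_pos _).le
      _ = M ^ r * D := by
          rw [hD, ← Real.exp_mul]
          congr 2
          ring
  have hT3 : K₀ * Y ^ r ≤ K₀ * (M ^ r * D) := mul_le_mul_of_nonneg_left hYr hK₀0.le
  have hsum : K₀ * Real.exp (-(κ * (gt * a ^ 4))) + ((J : ℝ) + 1) * (K₀ * Real.exp (-(θ / 2 * a ^ 4))) +
      K₀ * Y ^ r ≤ K₀ * (2 + b + M ^ r) * D := by
    calc _ ≤ K₀ * D + (b + 1) * K₀ * D + K₀ * (M ^ r * D) := add_le_add (add_le_add hT1 hT2) hT3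
      _ = K₀ * (2 + b + M ^ r) * D := by ring
  have he0 := Real.exp_pos (θ * a ^ 4)
  calc Real.exp (θ * a ^ 4) * (K₀ * Real.exp (-(κ * (gt * a ^ 4)))) +
        ((J : ℝ) + 1) * (Real.exp (θ * a ^ 4) * (K₀ * Real.exp (-(θ / 2 * a ^ 4)))) +
        K₀ * Real.exp (θ * a ^ 4) * Y ^ r
      = Real.exp (θ * a ^ 4) * (K₀ * Real.exp (-(κ * (gt * a ^ 4))) +
          ((J : ℝ) + 1) * (K₀ * Real.exp (-(θ / 2 * a ^ 4))) + K₀ * Y ^ r) := by ring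
    _ ≤ Real.exp (θ * a ^ 4) * (K₀ * (2 + b + M ^ r) * D) := mul_le_mul_of_nonneg_left hsum he0.le
    _ = K₀ * (2 + b + M ^ r) * (Real.exp (θ * a ^ 4) * D) := by ring

end Summit.AtomisticToContinuum.FouriersLaw.Cruxes.StaticKubo.Birth.Stubs

end
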